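import Summits.ResolutionOfSingularities.ResolutionOfSingularities.Theorems.FrobeniusLadderFRationalModificationRingCertificate
import Summits.ResolutionOfSingularities.ResolutionOfSingularities.Theorems.FrobeniusLadderFRationalModificationStalkSubmodels
import Summits.ResolutionOfSingularities.ResolutionOfSingularities.Theorems.FrobeniusLadderFRationalModificationCartierCertificate
import Summits.ResolutionOfSingularities.ResolutionOfSingularities.Theorems.FrobeniusLadderFRationalModificationTestElement
import Summits.ResolutionOfSingularities.ResolutionOfSingularities.Theorems.FRationalModification.Negative.LoadBearing
import Mathlib.AlgebraicGeometry.Noetherian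
import HarnessLib

/-!
# Certified stalks are rung-3 — over ANY ground field
(crux `FrobeniusLadder.FRationalModification`, lines `Sketch` v8 / `birth`, scheme-level consumer)

Crux `stmt-ResolutionOfSingularities-15316` (`FrobeniusLadder.FRationalModification`). The (D+) frame
("a modification regular off an effective Cartier divisor whose local rings are Cohen–Macaulay and
F-injective is F-rational") had its consumer proved in cycles 3–4 over F-FINITE ground fields only
(`CartierCertificateHolds.rungThree_stalk_of_cartierCertificate`, hypothesis `hk : IsFFinite p 1 k`),
because the Fedder–Watanabe inversion needs parameter test elements (Hochster–Huneke 1989 Thm 3.4,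
F-finite). Here the F-finiteness is REMOVED: stalks of schemes locally of finite type over any field have
faithfully flat Noetherian F-finite submodels through every finite subset
(`StalkSubmodels.stub_stalkSubmodels`, EGA IV₃ §8), along which pointwise test exponents descend
(`RingCertificate.isFRational_of_ringCertificate`). Two packagings:

* `rungThree_of_certificate` — the POINTWISE RING CERTIFICATE form consumed by line `Sketch` v8
  (`stub_certifiedModel`): a domain stalk that is rung-3 or has `t ∈ 𝔪 ∖ 0` with `𝒪[1/t]` regular and
  `𝒪/(t)` Cohen–Macaulay F-injective satisfies the crux's rung-3 clause;
* `rungThree_of_cartierCertificate` — the EFFECTIVE CARTIER DIVISOR form consumed by line `birth`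
  (`FRationalModification_of_hulls`, there modulo the hypothesis `ParameterTestElement` = Hochster–Huneke
  1994 Thm (6.2), HH94 §6 Γ-construction): along an effective Cartier divisor `D` with regular
  complement, a domain stalk `x ∈ Supp D` with `𝒪_{X,x}/D_x` Cohen–Macaulay F-injective is rung-3 —
  now WITHOUT that hypothesis (the pointwise exponents suffice for Fedder–Watanabe).

Everything is proved; no named facts.

## References

* R. Fedder, K.-i. Watanabe (1989), Prop. 2.13. [FedderWatanabe1989]
* M. Hochster, C. Huneke (1989), Thm. 3.4. [HochsterHuneke1989]
* A. Grothendieck, J. Dieudonné, EGA IV₃ (1966), §8. [EGAIV3]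
-/

-- single-problem summit: the doubled namespace component `ResolutionOfSingularities` is forced
set_option linter.dupNamespace false

noncomputable section

open CategoryTheory AlgebraicGeometry TopologicalSpace IsLocalRing
open Literature.RingTheory.TightClosure Literature.AlgebraicGeometry.Resolution
open Summit.ResolutionOfSingularities.ResolutionOfSingularities.Theorems.FRationalModification

namespace Summit.ResolutionOfSingularities.ResolutionOfSingularities.Theorems.FRationalModification.CertifiedModel

/-- **A certified stalk of a `k`-scheme is rung-3, for ANY field `k` of characteristic `p`.**
`f : X → Spec k` locally of finite type, `x ∈ X` with `𝒪_{X,x}` a domain that either satisfies the crux's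
rung-3 clause or carries a ring certificate (`t ∈ 𝔪 ∖ 0`, `𝒪_{X,x}[1/t]` a regular ring, `𝒪_{X,x}/(t)`
Cohen–Macaulay and F-injective in its own system-of-parameters language); then `𝒪_{X,x}` satisfies the
rung-3 clause (`StalkSubmodels.stub_stalkSubmodels` + `RingCertificate.isFRational_of_ringCertificate`
+ `isFRational_iff_of_isDomain`). This is the consumer of `stub_certifiedModel` (line `Sketch`, v8).
[cite: FedderWatanabe1989, Prop. 2.13; HochsterHuneke1989, Thm. 3.4; EGAIV3, Prop. 8.9.1] -/
theorem rungThree_of_certificate (p : ℕ) [Fact p.Prime] {k : Type} [Field k] [CharP k p]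
    {X : Scheme.{0}} (f : X ⟶ Spec (.of k)) [LocallyOfFiniteType f] (x : X)
    [IsDomain (X.presheaf.stalk x)]
    (hx : (∀ d : ℕ, ringKrullDim (X.presheaf.stalk x) = d → ∀ s : Fin d → X.presheaf.stalk x,
        (Ideal.span (Set.range s)).radical.IsMaximal → ∀ y c : X.presheaf.stalk x, c ≠ 0 →
          (∀ e : ℕ, c * y ^ p ^ e ∈
            Ideal.span ((fun z : X.presheaf.stalk x => z ^ p ^ e) ''
              (Ideal.span (Set.range s) : Set (X.presheaf.stalk x)))) →
          y ∈ Ideal.span (Set.range s)) ∨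
      ∃ t : X.presheaf.stalk x, t ∈ maximalIdeal (X.presheaf.stalk x) ∧ t ≠ 0 ∧
        IsRegularRing (Localization.Away t) ∧
        ∀ d : ℕ, ringKrullDim (X.presheaf.stalk x ⧸ Ideal.span {t}) = d →
          ∀ u : Fin d → X.presheaf.stalk x ⧸ Ideal.span {t},
            (Ideal.span (Set.range u)).radical.IsMaximal →
              RingTheory.Sequence.IsWeaklyRegular (X.presheaf.stalk x ⧸ Ideal.span {t})
                (List.ofFn u) ∧
              ∀ y : X.presheaf.stalk x ⧸ Ideal.span {t}, (∃ e : ℕ, y ^ p ^ e ∈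
                Ideal.span ((fun z : X.presheaf.stalk x ⧸ Ideal.span {t} => z ^ p ^ e) ''
                  (Ideal.span (Set.range u) : Set (X.presheaf.stalk x ⧸ Ideal.span {t})))) →
                y ∈ Ideal.span (Set.range u)) :
    ∀ d : ℕ, ringKrullDim (X.presheaf.stalk x) = d → ∀ s : Fin d → X.presheaf.stalk x,
      (Ideal.span (Set.range s)).radical.IsMaximal → ∀ y c : X.presheaf.stalk x, c ≠ 0 →
        (∀ e : ℕ, c * y ^ p ^ e ∈
          Ideal.span ((fun z : X.presheaf.stalk x => z ^ p ^ e) ''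
            (Ideal.span (Set.range s) : Set (X.presheaf.stalk x)))) →
        y ∈ Ideal.span (Set.range s) := by
  rcases hx with h3 | ⟨t, htm, ht0, hreg, hD⟩
  · exact h3
  · haveI : IsLocallyNoetherian X := LocallyOfFiniteType.isLocallyNoetherian f
    haveI : CharP (X.presheaf.stalk x) p := Negative.charP_stalk f x
    exact (isFRational_iff_of_isDomain p).mp
      (RingCertificate.isFRational_of_ringCertificate p (StalkSubmodels.stub_stalkSubmodels p f x)
        htm ht0 hreg hD)

/-- **Rung 3 along a Cohen–Macaulay F-injective effective Cartier divisor with regular complement —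
any ground field, no test-element hypothesis.** `f : X → Spec k` locally of finite type (`k` ANY field
of characteristic `p`), `D ⊂ X` an effective Cartier divisor (`IsEffectiveCartier`), `X` regular at
every point off `Supp D`, `x ∈ Supp D` with `𝒪_{X,x}` a domain of characteristic `p` whose local ring
`𝒪_{X,x}/D_x` of `D` is Cohen–Macaulay and F-injective (inline s.o.p. language). Then `𝒪_{X,x}` is a
domain satisfying the crux's rung-3 clause. Proof: a local equation `D_x = (g)`
(`CartierCertificate.exists_localEquation`); "regular off `Supp D`" gives `(𝒪_{X,x})_g` regular
(`TestElement.isRegularRing_away_of_generizations`, `CartierCertificate.not_isUnit_of_mem_support`); then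
`rungThree_of_certificate` with the ring certificate `t = g`. This is line `birth`'s
`rungThree_of_cartierCertificate` with its hypothesis `ParameterTestElement` (Hochster–Huneke 1994
Thm (6.2), Γ-construction) DISCHARGED by descent instead. [cite: FedderWatanabe1989, Prop. 2.13;
HochsterHuneke1989, Thm. 3.4; EGAIV3, Prop. 8.9.1] -/
theorem rungThree_of_cartierCertificate (p : ℕ) [Fact p.Prime] (k : Type) [Field k] [CharP k p]
    {X : Scheme.{0}} (f : X ⟶ Spec (.of k)) [LocallyOfFiniteType f] {D : X.IdealSheafData}
    (hD : IsEffectiveCartier D) {x : X} (hx : x ∈ D.support) [IsDomain (X.presheaf.stalk x)]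
    (hreg : ∀ x' : X, x' ∉ D.support → IsRegularLocalRing (X.presheaf.stalk x'))
    (hcert : ∀ d : ℕ, ringKrullDim (X.presheaf.stalk x ⧸ stalkIdeal D x) = d →
      ∀ t : Fin d → X.presheaf.stalk x ⧸ stalkIdeal D x,
        (Ideal.span (Set.range t)).radical.IsMaximal →
          RingTheory.Sequence.IsWeaklyRegular (X.presheaf.stalk x ⧸ stalkIdeal D x) (List.ofFn t) ∧
          ∀ y : X.presheaf.stalk x ⧸ stalkIdeal D x, (∃ e : ℕ, y ^ p ^ e ∈
            Ideal.span ((fun z : X.presheaf.stalk x ⧸ stalkIdeal D x => z ^ p ^ e) ''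
              (Ideal.span (Set.range t) : Set (X.presheaf.stalk x ⧸ stalkIdeal D x)))) →
            y ∈ Ideal.span (Set.range t)) :
    IsDomain (X.presheaf.stalk x) ∧
      ∀ d : ℕ, ringKrullDim (X.presheaf.stalk x) = d → ∀ s : Fin d → X.presheaf.stalk x,
        (Ideal.span (Set.range s)).radical.IsMaximal → ∀ y c : X.presheaf.stalk x, c ≠ 0 →
          (∀ e : ℕ, c * y ^ p ^ e ∈
            Ideal.span ((fun z : X.presheaf.stalk x => z ^ p ^ e) ''
              (Ideal.span (Set.range s) : Set (X.presheaf.stalk x)))) →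
          y ∈ Ideal.span (Set.range s) := by
  haveI : IsLocallyNoetherian X := LocallyOfFiniteType.isLocallyNoetherian f
  obtain ⟨g, hgm, hg0, hDg, -⟩ := CartierCertificate.exists_localEquation hD hx
  -- "regular off `Supp D`" ⇒ regular at the generizations where `g` is a unit ⇒ `(𝒪_{X,x})_g` regular
  have hreg' : ∀ (x' : X) (hx' : x' ⤳ x), IsUnit ((X.presheaf.stalkSpecializes hx').hom g) →
      IsRegularLocalRing (X.presheaf.stalk x') := fun x' hx' hu =>
    hreg x' fun hs => CartierCertificate.not_isUnit_of_mem_support hx' hDg hs hu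
  have haway : IsRegularRing (Localization.Away g) :=
    TestElement.isRegularRing_away_of_generizations x g hreg'
  -- the certificate is stated on `𝒪/D_x = 𝒪/(g)`
  revert hcert
  rw [hDg]
  intro hcert
  exact ⟨inferInstance, rungThree_of_certificate p f x (Or.inr ⟨g, hgm, hg0, haway, hcert⟩)⟩

end Summit.ResolutionOfSingularities.ResolutionOfSingularities.Theorems.FRationalModification.CertifiedModel

end
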